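import Literature.Geometry.Lorentzian.DivergenceTheorem
import Literature.Geometry.Lorentzian.GreenIdentityCompactSupport
import HarnessLib

/-!
# The divergence theorem for compactly supported vector fields on a (non-compact) Riemannian
# manifold: `∫_N div Y dμ_h = 0`

`DivergenceTheorem.lean` proves `∫_N div Y dμ_h = 0` for a `C¹` vector field `Y` on a **compact**
Riemannian manifold without boundary (Lee 2018, Problem 2-22 (a) with `∂M = ∅`). Flux arguments on
**non-compact** complete manifolds — the asymptotically flat ends of the positive mass theorem, and
the complete non-compact minimal surface `S` of Schoen–Yau's proof (Comm. Math. Phys. 65 (1979),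
§2, Step 3: the Gauss–Bonnet / divergence-theorem computations (2.26)–(2.30) on the exhaustion
`D_σ` of `S`) — need the same statement for **compactly supported** fields, where the boundary term
still vanishes. This file proves it, by the argument of `DivergenceTheorem.lean` verbatim with the
compactness of `N` replaced by the compactness of the support (all results proved, no named facts,
no definitions):

* `continuous_vectorDivergence_smul_of_tsupport_subset`, `vectorDivergence_smul_eq_sum` — for
  `ρ ∈ C¹(N)` supported in one chart domain and a `C¹` field `Y`, the chart decomposition
  `ρ Y = ∑ⱼ uⱼ grad fⱼ` (`uⱼ = ρ h(Y, ∂ⱼ)`, `fⱼ = ψ xʲ` globalised coordinate functions) and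
  `div(ρ Y) = ∑ⱼ (uⱼ Δ_h fⱼ + h⁻¹(duⱼ, dfⱼ))`, whence continuity of `div(ρ Y)` — on ANY manifold;
* `continuous_vectorDivergence` — **`div Y` is continuous for every `C¹` vector field `Y`** on any
  Riemannian manifold modelled on `ℝ^m` (localise with a bump function);
* `integral_vectorDivergence_smul_of_hasCompactSupport_of_tsupport_subset` — the divergence
  theorem for `ρ Y` with `ρ` supported in a chart domain and `Y` compactly supported (each summand
  integrates to zero by the compact-support Green identity
  `integral_mul_dalembertian_eq_neg_integral_innerDual_of_hasCompactSupport`);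
* `integral_vectorDivergence_eq_zero_of_hasCompactSupport` — **the divergence theorem for a
  compactly supported `C¹` vector field** on a (possibly non-compact) Riemannian manifold without
  boundary: `∫_N div Y dμ_h = 0` (a finite smooth partition of unity on the compact support
  subordinate to chart domains);
* `integral_mul_vectorDivergence_eq_neg_integral_mvfderiv_of_hasCompactSupport` (compact support
  on `u ∈ C¹_c(N)`) and `…_of_hasCompactSupport_right` (compact support on the field) — the
  integration by parts `∫_N u div Y dμ_h = −∫_N du(Y) dμ_h`.

Hypotheses as in `GreenIdentityCompactSupport.lean`: `N` a `C^∞` manifold modelled on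
`EuclideanSpace ℝ (Fin m)` with boundaryless model, `[T2Space N] [LocallyCompactSpace N]
[SigmaCompactSpace N] [MeasurableSpace N] [BorelSpace N]`, `h` a smooth Riemannian metric with
`[(ofRiemannian h).HasLeviCivita]`. The compact support of a vector field `Y : Π x, T_x N` is
written `HasCompactSupport fun x ↦ (Y x : EuclideanSpace ℝ (Fin m))` (the tangent spaces of the
tangent bundle are the model space by definition).

## References

* J. M. Lee, *Introduction to Riemannian Manifolds*, 2nd ed., GTM 176, Springer 2018,
  Problem 2-22 (a) (divergence theorem), Prop. 2.46, Problem 5-14 (`div X = tr ∇X`). [Lee2018]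
* R. Schoen, S.-T. Yau, *On the proof of the positive mass conjecture in general relativity*,
  Comm. Math. Phys. 65 (1979) 45–76, §2, pp. 58–59 ((2.26)–(2.30): the divergence theorem and the
  Gauss–Bonnet boundary terms on the non-compact minimal surface `S`). [SchoenYauPMT1979]
-/

noncomputable section

open Bundle Set Function Filter Manifold MeasureTheory Finset FiberBundle
open scoped Manifold ContDiff Topology

namespace Literature.Geometry.Lorentzian

open PseudoRiemannianMetric

/-! ### The chart decomposition of a localized field and the continuity of its divergence -/

section Local

variable {m : ℕ} {H : Type*} [TopologicalSpace H]
  {I : ModelWithCorners ℝ (EuclideanSpace ℝ (Fin m)) H} [I.Boundaryless]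
  {N : Type*} [TopologicalSpace N] [ChartedSpace H N] [IsManifold I ∞ N] [T2Space N]
  [LocallyCompactSpace N] [SigmaCompactSpace N]
  (h : ContMDiffRiemannianMetric I ∞ (EuclideanSpace ℝ (Fin m)) (TangentSpace I : N → Type _))
  [(ofRiemannian h).HasLeviCivita]

/-- **The divergence of a field localized in a chart domain, in divergence-of-gradients form.**
For `ρ ∈ C¹(N)` with `tsupport ρ` inside the chart domain of `x₀` and a `C¹` vector field `Y`
there are `uⱼ ∈ C¹(N)` (`uⱼ = ρ h(Y, ∂ⱼ)`, vanishing wherever `ρ` or `Y` vanishes) and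
`fⱼ ∈ C^∞(N)` (the coordinate functions globalised by a cut-off) with
`div(ρ Y) = ∑ⱼ (uⱼ Δ_h fⱼ + h⁻¹(duⱼ, dfⱼ))` everywhere; in particular `div(ρ Y)` is continuous.
This is the computation of `integral_vectorDivergence_smul_of_tsupport_subset`
(`DivergenceTheorem.lean`), which uses the compactness of the manifold only afterwards, in the
integration. Lee 2018, Problem 2-22 (a) and Problem 5-14. [cite: Lee2018, Problem 2-22 (a)] -/
theorem vectorDivergence_smul_eq_sum (x₀ : N) {ρ : N → ℝ} (hρ : CMDiff 1 ρ)
    (hsupp : tsupport ρ ⊆ (chartAt H x₀).source) {Y : Π x : N, TangentSpace I x}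
    (hY : CMDiff 1 (T% Y)) :
    ∃ (u : Fin m → N → ℝ) (f : Fin m → N → ℝ), (∀ j, CMDiff 1 (u j)) ∧ (∀ j, CMDiff ∞ (f j)) ∧
      (∀ j y, ρ y = 0 → u j y = 0) ∧ (∀ j y, Y y = 0 → u j y = 0) ∧
      ∀ y, (ofRiemannian h).vectorDivergence (ρ • Y) y =
        ∑ j, (u j y * (ofRiemannian h).dalembertian (f j) y +
          (ofRiemannian h).innerDual y (mvfderiv I (u j) y).toLinearMap
            (mvfderiv I (f j) y).toLinearMap) := by
  classical
  set g := ofRiemannian h with hg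
  set b : Module.Basis (Fin m) ℝ (EuclideanSpace ℝ (Fin m)) :=
    (EuclideanSpace.basisFun (Fin m) ℝ).toBasis with hb_def
  set U : Set N := (chartAt H x₀).source with hU
  have hUo : IsOpen U := (chartAt H x₀).open_source
  -- a smooth cut-off `ψ = 1` near `tsupport ρ` with `tsupport ψ ⊆ U`
  obtain ⟨ψ, hψ0, hψ1, -⟩ := exists_contMDiffMap_zero_one_nhds_of_isClosed I (n := (⊤ : ℕ∞))
    hUo.isClosed_compl (isClosed_tsupport ρ) (disjoint_compl_left_iff_subset.2 hsupp)
  obtain ⟨O, hO, hUO, hψO⟩ := eventually_nhdsSet_iff_exists.1 hψ0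
  have hψsupp : tsupport ψ ⊆ U := by
    refine closure_minimal (fun y hy ↦ ?_) hO.isClosed_compl |>.trans fun y hy ↦ ?_
    · exact fun hyO ↦ hy (hψO y hyO)
    · by_contra hyU; exact hy (hUO hyU)
  obtain ⟨O₁, hO₁, htO₁, hψO₁⟩ := eventually_nhdsSet_iff_exists.1 hψ1
  -- the globalized coordinate functions `fⱼ = ψ xʲ`
  set f : Fin m → N → ℝ := fun j y ↦ ψ y * chartCoord (I := I) b x₀ j y with hf_def
  have hf : ∀ j, CMDiff ∞ (f j) := fun j ↦ by
    refine contMDiff_of_tsupport fun y hy ↦ ?_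
    have hyU : y ∈ U := hψsupp (tsupport_mul_subset_left hy)
    exact ψ.contMDiff.contMDiffAt.mul (contMDiffAt_chartCoord b hyU j)
  have h2 : (2 : ℕ∞ω) ≤ ∞ := WithTop.coe_le_coe.mpr le_top
  have h1 : (1 : ℕ∞ω) ≤ ∞ := WithTop.coe_le_coe.mpr le_top
  have hf2 : ∀ j, CMDiff 2 (f j) := fun j ↦ (hf j).of_le h2
  have hfev : ∀ j, ∀ y ∈ tsupport ρ, f j =ᶠ[𝓝 y] chartCoord (I := I) b x₀ j := fun j y hy ↦ by
    filter_upwards [hO₁.mem_nhds (htO₁ hy)] with z hz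
    simp only [hf_def, hψO₁ z hz, one_mul]
  -- the coefficient functions `uⱼ = ρ h(Y, ∂ⱼ)`
  set s : Fin m → Π x : N, TangentSpace I x := fun j ↦
    (trivializationAt (EuclideanSpace ℝ (Fin m)) (TangentSpace I) x₀).localFrame b j with hs_def
  set u : Fin m → N → ℝ := fun j y ↦ ρ y * g.val y (Y y) (s j y) with hu_def
  have hu : ∀ j, CMDiff 1 (u j) := fun j ↦ by
    refine contMDiff_of_tsupport fun y hy ↦ ?_
    have hyU : y ∈ U := hsupp (tsupport_mul_subset_left hy)
    exact hρ.contMDiffAt.mul (g.contMDiffAt_val_apply h1 hY.contMDiffAt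
      ((contMDiffAt_localFrame_chart b hyU j).of_le h1))
  -- the gradients `Gⱼ = grad fⱼ`
  set G : Fin m → Π x : N, TangentSpace I x := fun j y ↦
    (g.sharp y (mvfderiv I (f j) y).toLinearMap : TangentSpace I y) with hG_def
  have hGd : ∀ j y, MDiffAt (T% (G j)) y := fun j y ↦
    g.mdifferentiableAt_sharp_mvfderiv ((hf2 j) y)
  -- the decomposition `ρ Y = ∑ⱼ uⱼ Gⱼ`
  have hdec : (ρ • Y : Π x : N, TangentSpace I x) = ∑ j, u j • G j := by
    funext y
    rw [Finset.sum_apply]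
    simp only [Pi.smul_apply']
    by_cases hy : y ∈ tsupport ρ
    · have hyU : y ∈ U := hsupp hy
      have hGj : ∀ j, G j y = g.sharp y (mvfderiv I (chartCoord (I := I) b x₀ j) y).toLinearMap :=
        fun j ↦ by simp only [hG_def, mvfderiv_congr_of_eventuallyEq (hfev j y hy)]
      simp only [hu_def, hGj, mul_smul, ← Finset.smul_sum]
      congr 1
      exact g.eq_sum_val_localFrame_smul_sharp_chartCoord b hyU (Y y)
    · have h0 : ρ y = 0 := image_eq_zero_of_notMem_tsupport hy
      have hu0 : ∀ j, u j y = 0 := fun j ↦ by simp only [hu_def, h0, zero_mul]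
      rw [h0, zero_smul]
      exact (Finset.sum_eq_zero fun j _ ↦ by rw [hu0 j, zero_smul]).symm
  refine ⟨u, f, hu, hf, fun j y hy0 ↦ by simp only [hu_def, hy0, zero_mul],
    fun j y hy0 ↦ by simp [hu_def, hy0],
    fun y ↦ ?_⟩
  -- the divergence, summand by summand
  rw [hdec, (vectorDivergence_finset_sum (g := g) Finset.univ (fun j _ ↦
    ((hu j y).mdifferentiableAt one_ne_zero).smul_section (hGd j y))).2]
  refine Finset.sum_congr rfl fun j _ ↦ ?_
  rw [vectorDivergence_smul (hGd j y) ((hu j y).mdifferentiableAt one_ne_zero),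
    vectorDivergence_sharp_mvfderiv ((hf2 j) y)]
  rfl

/-- **Continuity of the divergence of a field localized in a chart domain**: for `ρ ∈ C¹(N)` with
`tsupport ρ` inside a chart domain and a `C¹` vector field `Y`, `div(ρ Y)` is continuous (by the
divergence-of-gradients form `vectorDivergence_smul_eq_sum` and the continuity of `Δ_h f`,
`h⁻¹(du, df)` for `f ∈ C²`, `u ∈ C¹`). [folklore] -/
theorem continuous_vectorDivergence_smul_of_tsupport_subset (x₀ : N) {ρ : N → ℝ} (hρ : CMDiff 1 ρ)
    (hsupp : tsupport ρ ⊆ (chartAt H x₀).source) {Y : Π x : N, TangentSpace I x}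
    (hY : CMDiff 1 (T% Y)) :
    Continuous ((ofRiemannian h).vectorDivergence (ρ • Y)) := by
  obtain ⟨u, f, hu, hf, -, -, hdiv⟩ := vectorDivergence_smul_eq_sum h x₀ hρ hsupp hY
  have h2 : (2 : ℕ∞ω) ≤ ∞ := WithTop.coe_le_coe.mpr le_top
  have h1 : (1 : ℕ∞ω) ≤ ∞ := WithTop.coe_le_coe.mpr le_top
  rw [show (ofRiemannian h).vectorDivergence (ρ • Y) = _ from funext hdiv]
  refine continuous_finsetSum _ fun j _ ↦ ?_
  exact ((hu j).continuous.mul (continuous_dalembertian _ ((hf j).of_le h2))).add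
    (continuous_innerDual_mvfderiv _ (hu j) ((hf j).of_le h1))

/-- **The divergence of a `C¹` vector field is continuous** on any Riemannian manifold modelled on
`ℝ^m` (boundaryless model). Proof: near `x₀` the field `Y` agrees with `ρ Y` for a smooth bump `ρ`
supported in the chart domain of `x₀` and equal to `1` near `x₀`; the divergence is local
(`div(ρ Y)(y) = ρ(y) div Y(y) + dρ_y(Y) = div Y(y)` where `ρ ≡ 1`), and `div(ρ Y)` is continuous
(`continuous_vectorDivergence_smul_of_tsupport_subset`). [folklore] -/
theorem continuous_vectorDivergence {Y : Π x : N, TangentSpace I x} (hY : CMDiff 1 (T% Y)) :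
    Continuous ((ofRiemannian h).vectorDivergence Y) := by
  set g := ofRiemannian h with hg
  rw [continuous_iff_continuousAt]
  intro x₀
  -- a smooth bump `ρ = 1` near `x₀`, supported in the chart domain of `x₀`
  have hUo : IsOpen (chartAt H x₀).source := (chartAt H x₀).open_source
  obtain ⟨ρ, hρ0, hρ1, -⟩ := exists_contMDiffMap_zero_one_nhds_of_isClosed I (n := (⊤ : ℕ∞))
    hUo.isClosed_compl isClosed_singleton
    (disjoint_compl_left_iff_subset.2 (singleton_subset_iff.2 (mem_chart_source H x₀)))
  obtain ⟨O, hO, hUO, hρO⟩ := eventually_nhdsSet_iff_exists.1 hρ0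
  have hρsupp : tsupport ρ ⊆ (chartAt H x₀).source := by
    refine closure_minimal (fun y hy ↦ ?_) hO.isClosed_compl |>.trans fun y hy ↦ ?_
    · exact fun hyO ↦ hy (hρO y hyO)
    · by_contra hyU; exact hy (hUO hyU)
  obtain ⟨O₁, hO₁, hxO₁, hρO₁⟩ := eventually_nhdsSet_iff_exists.1 hρ1
  have hx₁ : x₀ ∈ O₁ := hxO₁ (mem_singleton x₀)
  have hρs : CMDiff 1 (ρ : N → ℝ) := ρ.contMDiff.of_le (by exact_mod_cast le_top)
  have hcont := continuous_vectorDivergence_smul_of_tsupport_subset h x₀ hρs hρsupp hY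
  -- `div Y = div (ρ Y)` near `x₀`
  have hev : g.vectorDivergence Y =ᶠ[𝓝 x₀] g.vectorDivergence ((ρ : N → ℝ) • Y) := by
    filter_upwards [hO₁.mem_nhds hx₁] with y hy
    have hρy : MDiffAt (ρ : N → ℝ) y := (hρs y).mdifferentiableAt one_ne_zero
    rw [vectorDivergence_smul ((hY y).mdifferentiableAt one_ne_zero) hρy, hρO₁ y hy, one_mul]
    have hd0 : mvfderiv I (ρ : N → ℝ) y = 0 := by
      have hc : (ρ : N → ℝ) =ᶠ[𝓝 y] fun _ ↦ (1 : ℝ) := by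
        filter_upwards [hO₁.mem_nhds hy] with z hz
        exact hρO₁ z hz
      rw [mvfderiv_congr_of_eventuallyEq hc]
      ext v
      simp [mvfderiv]
    rw [hd0]
    simp
  exact (hcont.continuousAt.congr_of_eventuallyEq hev :)

end Local

/-! ### The divergence theorem for compactly supported fields -/

section CompactSupport

variable {m : ℕ} {H : Type*} [TopologicalSpace H]
  {I : ModelWithCorners ℝ (EuclideanSpace ℝ (Fin m)) H} [I.Boundaryless]
  {N : Type*} [TopologicalSpace N] [ChartedSpace H N] [IsManifold I ∞ N]
  [T2Space N] [LocallyCompactSpace N] [SigmaCompactSpace N] [MeasurableSpace N] [BorelSpace N]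
  (h : ContMDiffRiemannianMetric I ∞ (EuclideanSpace ℝ (Fin m)) (TangentSpace I : N → Type _))
  [(ofRiemannian h).HasLeviCivita]

/-- **The divergence theorem for a compactly supported field localized in a chart domain.** On a
Riemannian manifold `(N, h)` modelled on `ℝ^m` (boundaryless, not necessarily compact), for a
`C¹` vector field `Y` of compact support and `ρ ∈ C¹(N)` with `tsupport ρ` inside the chart domain
of `x₀`: `∫_N div(ρ Y) dμ_h = 0`. Proof: `div(ρ Y) = ∑ⱼ (uⱼ Δ_h fⱼ + h⁻¹(duⱼ, dfⱼ))` with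
`uⱼ ∈ C¹_c(N)` (`vectorDivergence_smul_eq_sum`; `uⱼ` vanishes wherever `Y` does), and each
summand integrates to zero by Green's first identity for compactly supported functions
(`integral_mul_dalembertian_eq_neg_integral_innerDual_of_hasCompactSupport`). Lee 2018,
Problem 2-22 (a), with `∂M = ∅`. [cite: Lee2018, Problem 2-22 (a)] -/
theorem integral_vectorDivergence_smul_of_hasCompactSupport_of_tsupport_subset (x₀ : N)
    {ρ : N → ℝ} (hρ : CMDiff 1 ρ) (hsupp : tsupport ρ ⊆ (chartAt H x₀).source)
    {Y : Π x : N, TangentSpace I x} (hY : CMDiff 1 (T% Y))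
    (hYc : HasCompactSupport fun x ↦ (Y x : EuclideanSpace ℝ (Fin m))) :
    ∫ p, (ofRiemannian h).vectorDivergence (ρ • Y) p ∂riemannianMeasure h = 0 := by
  set g := ofRiemannian h with hg
  obtain ⟨u, f, hu, hf, -, huY, hdiv⟩ := vectorDivergence_smul_eq_sum h x₀ hρ hsupp hY
  have h2 : (2 : ℕ∞ω) ≤ ∞ := WithTop.coe_le_coe.mpr le_top
  have h1 : (1 : ℕ∞ω) ≤ ∞ := WithTop.coe_le_coe.mpr le_top
  have hf2 : ∀ j, CMDiff 2 (f j) := fun j ↦ (hf j).of_le h2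
  have hf1 : ∀ j, CMDiff 1 (f j) := fun j ↦ (hf j).of_le h1
  -- the coefficients are compactly supported (they vanish with `Y`)
  have huc : ∀ j, HasCompactSupport (u j) := fun j ↦ by
    refine hYc.mono fun y hy ↦ ?_
    rw [Function.mem_support] at hy ⊢
    exact fun h0 ↦ hy (huY j y h0)
  have hi1 : ∀ j, Integrable (fun a ↦ u j a * g.dalembertian (f j) a) (riemannianMeasure h) :=
    fun j ↦ integrable_of_continuous_of_hasCompactSupport h
      ((hu j).continuous.mul (continuous_dalembertian _ (hf2 j))) (huc j).mul_right
  have hi2 : ∀ j, Integrable (fun a ↦ g.innerDual a (mvfderiv I (u j) a).toLinearMap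
      (mvfderiv I (f j) a).toLinearMap) (riemannianMeasure h) := fun j ↦ by
    refine integrable_of_continuous_of_hasCompactSupport h
      (continuous_innerDual_mvfderiv _ (hu j) (hf1 j)) ?_
    refine HasCompactSupport.intro' (huc j).isCompact (isClosed_tsupport _) fun y hy ↦ ?_
    rw [mvfderiv_eq_zero_of_notMem_tsupport hy]
    simp [PseudoRiemannianMetric.innerDual]
  have hi : ∀ j, Integrable (fun a ↦ u j a * g.dalembertian (f j) a + g.innerDual a
      (mvfderiv I (u j) a).toLinearMap (mvfderiv I (f j) a).toLinearMap) (riemannianMeasure h) :=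
    fun j ↦ (hi1 j).add (hi2 j)
  rw [show g.vectorDivergence (ρ • Y) = _ from funext hdiv]
  beta_reduce
  rw [integral_finsetSum _ (fun j _ ↦ hi j)]
  refine Finset.sum_eq_zero fun j _ ↦ ?_
  rw [integral_add (hi1 j) (hi2 j),
    integral_mul_dalembertian_eq_neg_integral_innerDual_of_hasCompactSupport h (hu j) (huc j)
      (hf2 j)]
  ring

/-- **The divergence theorem for compactly supported vector fields.** Let `(N, h)` be a
Riemannian manifold without boundary modelled on `ℝ^m` (not necessarily compact; Hausdorff,
locally compact, σ-compact) and `Y` a `C¹` vector field of compact support. Then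
`∫_N div Y dμ_h = 0`, `div Y = tr ∇Y` (Levi-Civita connection), `μ_h` the Riemannian measure.
Proof: a finite smooth partition of unity `(ρᵢ)` on the compact support of `Y` subordinate to
chart domains (Mathlib's `SmoothPartitionOfUnity.exists_isSubordinate`) gives `Y = ∑ᵢ ρᵢ Y`
everywhere, `div Y = ∑ᵢ div(ρᵢ Y)` (`vectorDivergence_finset_sum`), and each piece integrates to
zero (`integral_vectorDivergence_smul_of_hasCompactSupport_of_tsupport_subset`). Lee 2018,
Problem 2-22 (a) (`∫_M div X dV_g = ∫_{∂M} ⟨X, N⟩ dV_ĝ`, here for compactly supported `X` and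
`∂M = ∅`); this is the form in which the divergence theorem is used on the complete non-compact
surface `S` of Schoen–Yau 1979, §2 (pp. 58–59). [cite: Lee2018, Problem 2-22 (a)] -/
theorem integral_vectorDivergence_eq_zero_of_hasCompactSupport {Y : Π x : N, TangentSpace I x}
    (hY : CMDiff 1 (T% Y)) (hYc : HasCompactSupport fun x ↦ (Y x : EuclideanSpace ℝ (Fin m))) :
    ∫ p, (ofRiemannian h).vectorDivergence Y p ∂riemannianMeasure h = 0 := by
  classical
  set g := ofRiemannian h with hg
  set K : Set N := tsupport fun x ↦ (Y x : EuclideanSpace ℝ (Fin m)) with hK_def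
  have hK : IsCompact K := hYc
  -- a finite cover of `K` by chart domains and a smooth partition of unity on it
  obtain ⟨t, -, ht⟩ := hK.elim_nhds_subcover (fun x : N ↦ (chartAt H x).source)
    (fun x _ ↦ (chartAt H x).open_source.mem_nhds (mem_chart_source H x))
  obtain ⟨ρ, hρ⟩ := SmoothPartitionOfUnity.exists_isSubordinate I (isClosed_tsupport _)
    (fun i : t ↦ (chartAt H (i : N)).source) (fun i ↦ (chartAt H (i : N)).open_source) (by
      intro p hp
      have hp' : p ∈ ⋃ x ∈ t, (chartAt H x).source := ht hp
      simp only [mem_iUnion] at hp' ⊢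
      obtain ⟨x, hx, hpx⟩ := hp'
      exact ⟨⟨x, hx⟩, hpx⟩)
  have hsum : ∀ p ∈ K, ∑ i, ρ i p = 1 := fun p hp ↦ by
    rw [← finsum_eq_sum_of_fintype]
    exact ρ.sum_eq_one hp
  have hρ1 : ∀ i, CMDiff 1 (ρ i) := fun i ↦ (ρ i).contMDiff.of_le (by exact_mod_cast le_top)
  -- `Y = ∑ᵢ ρᵢ Y` everywhere (on `K` the `ρᵢ` sum to `1`, off `K` both sides vanish)
  have hdec : Y = ∑ i, ((ρ i : N → ℝ) • Y : Π x : N, TangentSpace I x) := by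
    funext p
    rw [Finset.sum_apply]
    simp only [Pi.smul_apply', ← Finset.sum_smul]
    by_cases hp : p ∈ K
    · rw [hsum p hp, one_smul]
    · have h0 : Y p = 0 := image_eq_zero_of_notMem_tsupport hp
      rw [h0, smul_zero]
  have hdiv : g.vectorDivergence Y = fun p ↦ ∑ i, g.vectorDivergence ((ρ i : N → ℝ) • Y) p := by
    funext p
    conv_lhs => rw [hdec]
    exact (vectorDivergence_finset_sum (g := g) Finset.univ (fun i _ ↦
      (((hρ1 i) p).mdifferentiableAt one_ne_zero).smul_section
        ((hY p).mdifferentiableAt one_ne_zero))).2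
  -- each piece is continuous, compactly supported and integrates to zero
  have hci : ∀ i, Continuous (g.vectorDivergence ((ρ i : N → ℝ) • Y)) := fun i ↦
    continuous_vectorDivergence_smul_of_tsupport_subset h (i : N) (hρ1 i) (hρ i) hY
  have hsc : ∀ i, HasCompactSupport (g.vectorDivergence ((ρ i : N → ℝ) • Y)) := fun i ↦ by
    refine HasCompactSupport.intro' hK (isClosed_tsupport _) fun y hy ↦ ?_
    refine vectorDivergence_eq_zero_of_eventuallyEq_zero ?_
    filter_upwards [(isClosed_tsupport _).isOpen_compl.mem_nhds hy] with z hz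
    have hz0 : Y z = 0 := image_eq_zero_of_notMem_tsupport hz
    show ρ i z • Y z = 0
    rw [hz0, smul_zero]
  have hint : ∀ i, Integrable (g.vectorDivergence ((ρ i : N → ℝ) • Y)) (riemannianMeasure h) :=
    fun i ↦ integrable_of_continuous_of_hasCompactSupport h (hci i) (hsc i)
  rw [hdiv, integral_finsetSum _ (fun i _ ↦ hint i)]
  exact Finset.sum_eq_zero fun i _ ↦
    integral_vectorDivergence_smul_of_hasCompactSupport_of_tsupport_subset h (i : N) (hρ1 i)
      (hρ i) hY hYc

/-- **Integration by parts against a vector field, compactly supported function**: for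
`u ∈ C¹_c(N)` and a `C¹` vector field `Y` on a Riemannian manifold without boundary modelled on
`ℝ^m`, `∫_N u div Y dμ_h = −∫_N du(Y) dμ_h` (the divergence theorem for the compactly supported
field `u Y`, `div(uY) = u div Y + du(Y)`). Lee 2018, Problem 2-22 (a).
[cite: Lee2018, Problem 2-22 (a)] -/
theorem integral_mul_vectorDivergence_eq_neg_integral_mvfderiv_of_hasCompactSupport
    {u : N → ℝ} (hu : CMDiff 1 u) (huc : HasCompactSupport u)
    {Y : Π x : N, TangentSpace I x} (hY : CMDiff 1 (T% Y)) :
    ∫ p, u p * (ofRiemannian h).vectorDivergence Y p ∂riemannianMeasure h =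
      -∫ p, mvfderiv I u p (Y p) ∂riemannianMeasure h := by
  set g := ofRiemannian h with hg
  have huY : CMDiff 1 (T% ((u : N → ℝ) • Y : Π x : N, TangentSpace I x)) := hu.smul_section hY
  have huYc : HasCompactSupport fun x ↦ (((u : N → ℝ) • Y : Π x : N, TangentSpace I x) x :
      EuclideanSpace ℝ (Fin m)) := by
    refine huc.mono fun y hy ↦ ?_
    rw [Function.mem_support] at hy ⊢
    intro h0
    apply hy
    show u y • Y y = 0
    rw [h0, zero_smul]
  have h0 := integral_vectorDivergence_eq_zero_of_hasCompactSupport h huY huYc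
  have hcY : Continuous (g.vectorDivergence Y) := continuous_vectorDivergence h hY
  have hc : Continuous (g.vectorDivergence ((u : N → ℝ) • Y)) := continuous_vectorDivergence h huY
  have heq : g.vectorDivergence ((u : N → ℝ) • Y) =
      fun p ↦ u p * g.vectorDivergence Y p + mvfderiv I u p (Y p) :=
    funext fun p ↦ vectorDivergence_smul ((hY p).mdifferentiableAt one_ne_zero)
      ((hu p).mdifferentiableAt one_ne_zero)
  have hi1 : Integrable (fun p ↦ u p * g.vectorDivergence Y p) (riemannianMeasure h) :=
    integrable_of_continuous_of_hasCompactSupport h (hu.continuous.mul hcY) huc.mul_right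
  have hi2 : Integrable (fun p ↦ mvfderiv I u p (Y p)) (riemannianMeasure h) := by
    have hc2 : Continuous (fun p ↦ u p * g.vectorDivergence Y p + mvfderiv I u p (Y p)) := by
      rw [← heq]; exact hc
    have hc3 := hc2.sub (hu.continuous.mul hcY)
    refine integrable_of_continuous_of_hasCompactSupport h (hc3.congr fun p ↦ ?_) ?_
    · simp only [Pi.sub_apply, Pi.mul_apply, add_sub_cancel_left]
    · refine HasCompactSupport.intro' huc.isCompact (isClosed_tsupport _) fun y hy ↦ ?_
      rw [mvfderiv_eq_zero_of_notMem_tsupport hy]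
      rfl
  rw [heq, integral_add hi1 hi2] at h0
  linarith

/-- **Integration by parts against a compactly supported vector field**: for `u ∈ C¹(N)` and a
`C¹` vector field `Y` of compact support on a Riemannian manifold without boundary modelled on
`ℝ^m`, `∫_N u div Y dμ_h = −∫_N du(Y) dμ_h`. Lee 2018, Problem 2-22 (a).
[cite: Lee2018, Problem 2-22 (a)] -/
theorem integral_mul_vectorDivergence_eq_neg_integral_mvfderiv_of_hasCompactSupport_right
    {u : N → ℝ} (hu : CMDiff 1 u) {Y : Π x : N, TangentSpace I x} (hY : CMDiff 1 (T% Y))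
    (hYc : HasCompactSupport fun x ↦ (Y x : EuclideanSpace ℝ (Fin m))) :
    ∫ p, u p * (ofRiemannian h).vectorDivergence Y p ∂riemannianMeasure h =
      -∫ p, mvfderiv I u p (Y p) ∂riemannianMeasure h := by
  set g := ofRiemannian h with hg
  have huY : CMDiff 1 (T% ((u : N → ℝ) • Y : Π x : N, TangentSpace I x)) := hu.smul_section hY
  have huYc : HasCompactSupport fun x ↦ (((u : N → ℝ) • Y : Π x : N, TangentSpace I x) x :
      EuclideanSpace ℝ (Fin m)) := by
    refine hYc.mono fun y hy ↦ ?_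
    rw [Function.mem_support] at hy ⊢
    intro (h0 : Y y = 0)
    apply hy
    show u y • Y y = 0
    rw [h0, smul_zero]
  have h0 := integral_vectorDivergence_eq_zero_of_hasCompactSupport h huY huYc
  have hcY : Continuous (g.vectorDivergence Y) := continuous_vectorDivergence h hY
  have hc : Continuous (g.vectorDivergence ((u : N → ℝ) • Y)) := continuous_vectorDivergence h huY
  have heq : g.vectorDivergence ((u : N → ℝ) • Y) =
      fun p ↦ u p * g.vectorDivergence Y p + mvfderiv I u p (Y p) :=
    funext fun p ↦ vectorDivergence_smul ((hY p).mdifferentiableAt one_ne_zero)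
      ((hu p).mdifferentiableAt one_ne_zero)
  -- `div Y` is supported in the support of `Y`
  have hdivc : HasCompactSupport (g.vectorDivergence Y) := by
    refine HasCompactSupport.intro' hYc.isCompact (isClosed_tsupport _) fun y hy ↦ ?_
    refine vectorDivergence_eq_zero_of_eventuallyEq_zero ?_
    filter_upwards [(isClosed_tsupport _).isOpen_compl.mem_nhds hy] with z hz
    exact image_eq_zero_of_notMem_tsupport hz
  have hi1 : Integrable (fun p ↦ u p * g.vectorDivergence Y p) (riemannianMeasure h) :=
    integrable_of_continuous_of_hasCompactSupport h (hu.continuous.mul hcY) hdivc.mul_left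
  have hi2 : Integrable (fun p ↦ mvfderiv I u p (Y p)) (riemannianMeasure h) := by
    have hc2 : Continuous (fun p ↦ u p * g.vectorDivergence Y p + mvfderiv I u p (Y p)) := by
      rw [← heq]; exact hc
    have hc3 := hc2.sub (hu.continuous.mul hcY)
    refine integrable_of_continuous_of_hasCompactSupport h (hc3.congr fun p ↦ ?_) ?_
    · simp only [Pi.sub_apply, Pi.mul_apply, add_sub_cancel_left]
    · refine hYc.mono fun y hy ↦ ?_
      rw [Function.mem_support] at hy ⊢
      intro (h0 : Y y = 0)
      apply hy
      rw [h0, map_zero]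
  rw [heq, integral_add hi1 hi2] at h0
  linarith

end CompactSupport

end Literature.Geometry.Lorentzian

end
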